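import Literature.Analysis.FluidPDE.NormalisedPressureLpClass
import Literature.Analysis.FluidPDE.NormalisedPressureSliceMeasurabilityLp
import Literature.Analysis.FluidPDE.MollifiedLerayDistributional
import Literature.Analysis.FluidPDE.PressureEquationSlicing
import HarnessLib

/-!
# [BT1] the Riesz pressure `p̃_ε` of the mollified perturbed Leray system

Analysis/FluidPDE proof file (theorems only; no definitions, no named facts) in the DAG below the
named fact `Literature.Analysis.FluidPDE.bradshawTsai2017_thm_2_4_mollified`
(`PeriodicLerayExistence.lean`; Bradshaw–Tsai, Ann. Henri Poincaré 18 (2017) = arXiv:1510.07504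
[BT1], proof of Thm 2.4): "Let
`p̃_ε = Σᵢⱼ RᵢRⱼ[(η_ε * Uᵢ)Uⱼ + WᵢUⱼ + UᵢWⱼ + WᵢWⱼ]`, where `Rᵢ` denote the Riesz transforms. It
also satisfies `−Δp = Σ ∂ᵢ∂ⱼ[…]` … apply the Calderon–Zygmund theory to obtain an a priori bound
… `‖p_ε‖_{L^{5/3}(ℝ³×[0,T])} ≤ C‖U_ε‖²_{L^{10/3}(ℝ³×[0,T])} + C‖W‖²_{L^{10/3}(ℝ³×[0,T])}`".

The tree's Riesz-transform pressure is the *quadratic* normalised pressure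
`p̃[w] = −|w|²/3 + p.v.∫ K(x−y)(w(y)) dy` (`normalisedPressure`), with, on the class `w ∈ L²ᵖ`,
measurability, Stein's bound and the weak Poisson equation `∫ p̃[w] Δθ = −∫ D²θ(w, w)`
(`NormalisedPressureLpClass`, `NormalisedPressureSliceMeasurabilityLp`). The bilinear tensor of
[BT1] is reached by **polarisation**: with `u = U + W`, `b = W + V` (`V = η_ε * U`), the
symmetric part of `b ⊗ U + u ⊗ W = W⊗U + V⊗U + U⊗W + W⊗W` is
`(u⊗u) − (3/2)(U⊗U) + ½((U+V)⊗(U+V)) − ½(V⊗V)` symmetrised, so that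

  `p := p̃[U + W] − (3/2) p̃[U] + ½ p̃[U + V] − ½ p̃[V]`

solves, slice by slice, `∫ p Δθ = −∫ (D²θ(b, U) + D²θ(u, W))` — the weak pressure Poisson
equation in the form consumed by `BradshawTsai2017.distributional_of_veryWeak_slices`
(`MollifiedLerayDistributional`). This file proves (`BradshawTsai2017.exists_rieszPressure`):
for `T`-periodic jointly measurable `U`, `W`, `V` in `L^{10/3}` of every time slab there is such
a `p`, `T`-periodic, a.e.-strongly measurable, in `L^{5/3}` of every time slab (hence locally
integrable), with the slice-wise weak Poisson equation for a.e. time, and with the quantitative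
bound `∫∫_{(0,T)×ℝ³} |p|^{5/3} ≤ C ∫∫_{(0,T)×ℝ³} (|U|^{10/3} + |W|^{10/3} + |V|^{10/3})` for an
absolute `C` (Stein's constant): the `ε`-independence of the pressure bound of
`IsMollifiedPeriodicWeakSolution`.

## Mathlib / tree search

Tree (all used): `normalisedPressure` (`NormalisedPressure`);
`memLp_normalisedPressure_of_memLp_two_mul`, `memLp_norm_sq_of_memLp_two_mul`,
`integral_normalisedPressure_mul_laplacian_of_memLp` (`NormalisedPressureLpClass`);
`aestronglyMeasurable_normalisedPressure_slab`, `lintegral_slab_normalisedPressure_rpow_le`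
(`NormalisedPressureSliceMeasurabilityLp`); `locallyIntegrable_of_memLp_slab`,
`volume_restrict_Icc_prod_univ` (`MollifiedLerayDistributional`);
`integrable_bilin_apply_self_of_eq_zero_off_compact`, `fderiv_fderiv_eq_zero_of_notMem_tsupport`
(`PressureEquationSlicing`, `PressureSliceDecay`).
`lean search 'rieszPressure|normalisedPressure.*polar'`: polarised Riesz pressures exist for
classical drift systems (`LeraySchemePressure`, `¼(p̃[w+u] − p̃[w−u])`), not for the [BT1] tensor
nor as a space–time object on slabs. Mathlib: `AEStronglyMeasurable.prodMk_left`,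
`lintegral_prod`, `ae_lt_top'`, `ENNReal.rpow_add_le_mul_rpow_add_rpow`.

## References

* Z. Bradshaw, T.-P. Tsai, Ann. Henri Poincaré 18 (2017) = arXiv:1510.07504, proof of Thm 2.4
  (the pressure `p̃_ε`, its Poisson equation and its `L^{5/3}` bound) [BradshawTsai2017AHP].
* E. M. Stein, *Singular integrals and differentiability properties of functions* (1970),
  Ch. II §4.2 Thm 3 [Stein1971].
-/

noncomputable section

open MeasureTheory Set Function Filter Topology TopologicalSpace Metric
open scoped NNReal ENNReal InnerProductSpace RealInnerProductSpace ContDiff Laplacian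

namespace Literature.Analysis.FluidPDE

namespace BradshawTsai2017

/-! ### Exponents -/

/-- `2 · (5/3) = 10/3` in `ℝ≥0∞`. [folklore] -/
theorem two_mul_five_thirds : (2 : ℝ≥0∞) * (5 / 3) = 10 / 3 := by
  rw [← mul_div_assoc]
  norm_num

/-- `1 < 5/3` in `ℝ≥0∞`. [folklore] -/
theorem one_lt_five_thirds : (1 : ℝ≥0∞) < 5 / 3 := by
  rw [ENNReal.lt_div_iff_mul_lt (Or.inl (by norm_num)) (Or.inl (by norm_num))]
  norm_num

/-- `5/3 < ∞` in `ℝ≥0∞`. [folklore] -/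
theorem five_thirds_lt_top : (5 / 3 : ℝ≥0∞) < ⊤ :=
  ENNReal.div_lt_top (by norm_num) (by norm_num)

/-- `(5/3).toReal = 5/3`. [folklore] -/
theorem toReal_five_thirds : (5 / 3 : ℝ≥0∞).toReal = 5 / 3 := by
  rw [ENNReal.toReal_div]; norm_num

/-! ### Slices of slab classes -/

variable {G' : Type*} [NormedAddCommGroup G']

/-- **Almost every slice of a field in `L^q` of every time slab is in `L^q(ℝ³)`** (Tonelli on the
slabs `[-n, n] × ℝ³`), `0 < q < ∞`. [folklore] -/
theorem ae_memLp_slice_of_memLp_slabs {F : ℝ → EuclideanSpace ℝ (Fin 3) → G'} {q : ℝ≥0∞}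
    (hq0 : q ≠ 0) (hqt : q ≠ ⊤)
    (hF : ∀ a b : ℝ, MemLp (uncurry F) q
      (volume.restrict (Icc a b ×ˢ (univ : Set (EuclideanSpace ℝ (Fin 3)))))) :
    ∀ᵐ s : ℝ, MemLp (F s) q volume := by
  have hn : ∀ n : ℕ, ∀ᵐ s : ℝ, s ∈ Icc (-(n : ℝ)) n → MemLp (F s) q volume := by
    intro n
    have h := hF (-(n : ℝ)) n
    rw [volume_restrict_Icc_prod_univ] at h
    have hslice : ∀ᵐ s ∂(volume.restrict (Icc (-(n : ℝ)) n)),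
        AEStronglyMeasurable (fun y => uncurry F (s, y)) volume := h.1.prodMk_left
    have hfin := lintegral_rpow_enorm_lt_top_of_eLpNorm_lt_top hq0 hqt h.2
    rw [lintegral_prod _ (h.1.enorm.pow_const _)] at hfin
    have hint : AEMeasurable (fun s => ∫⁻ y, ‖uncurry F (s, y)‖ₑ ^ q.toReal)
        (volume.restrict (Icc (-(n : ℝ)) n)) := (h.1.enorm.pow_const _).lintegral_prod_right'
    have hfin' := ae_lt_top' hint hfin.ne
    have h2 : ∀ᵐ s ∂(volume.restrict (Icc (-(n : ℝ)) n)), MemLp (F s) q volume := by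
      filter_upwards [hslice, hfin'] with s h1 h2
      exact ⟨h1, (eLpNorm_lt_top_iff_lintegral_rpow_enorm_lt_top hq0 hqt).2 h2⟩
    exact (ae_restrict_iff' measurableSet_Icc).1 h2
  rw [← ae_all_iff] at hn
  filter_upwards [hn] with s hs
  obtain ⟨n, hn⟩ := exists_nat_ge |s|
  have hsn : s ∈ Icc (-(n : ℝ)) n := by
    rw [abs_le] at hn
    exact ⟨hn.1, hn.2⟩
  exact hs n hsn

/-! ### The polarised Riesz pressure -/

variable {T : ℝ} {U W V : ℝ → EuclideanSpace ℝ (Fin 3) → EuclideanSpace ℝ (Fin 3)}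

/-- Symmetry of the second derivative of a smooth function: `D²φ(y)(a)(b) = D²φ(y)(b)(a)`.
[folklore] -/
theorem fderiv_fderiv_symm {φ : EuclideanSpace ℝ (Fin 3) → ℝ} (hφ : ContDiff ℝ (⊤ : ℕ∞) φ)
    (y a b : EuclideanSpace ℝ (Fin 3)) :
    fderiv ℝ (fderiv ℝ φ) y a b = fderiv ℝ (fderiv ℝ φ) y b a := by
  have h2 : ContDiffAt ℝ 2 φ y := (hφ.of_le (by norm_cast)).contDiffAt
  have hmin : minSmoothness ℝ 2 ≤ (2 : ℕ∞ω) := by rw [minSmoothness_of_isRCLikeNormedField]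
  exact (h2.isSymmSndFDerivAt hmin).eq a b

/-- **The polarisation identity behind `p̃_ε`**: pointwise, for a smooth `φ`,
`D²φ(U+W, U+W) − (3/2)D²φ(U,U) + ½D²φ(U+V, U+V) − ½D²φ(V,V) = D²φ(W+V, U) + D²φ(U+W, W)`
(bilinearity and symmetry of `D²φ`). [cite: BradshawTsai2017AHP, proof of Thm 2.4 (the tensor (η_ε*U)⊗U + W⊗U + U⊗W + W⊗W)] -/
theorem hessian_polarisation {φ : EuclideanSpace ℝ (Fin 3) → ℝ} (hφ : ContDiff ℝ (⊤ : ℕ∞) φ)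
    (y a w v : EuclideanSpace ℝ (Fin 3)) :
    fderiv ℝ (fderiv ℝ φ) y (a + w) (a + w) - (3 / 2) * fderiv ℝ (fderiv ℝ φ) y a a +
      (1 / 2) * fderiv ℝ (fderiv ℝ φ) y (a + v) (a + v) - (1 / 2) * fderiv ℝ (fderiv ℝ φ) y v v =
      fderiv ℝ (fderiv ℝ φ) y (w + v) a + fderiv ℝ (fderiv ℝ φ) y (a + w) w := by
  have hs := fderiv_fderiv_symm hφ y
  simp only [map_add, add_apply]
  rw [hs w a, hs v a]
  ring

/-- `(a + b + c + d)^{5/3} ≤ 4 (a^{5/3} + b^{5/3} + c^{5/3} + d^{5/3})`. [folklore] -/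
theorem rpow_five_thirds_add_four_le (a b c d : ℝ≥0∞) :
    (a + b + c + d) ^ (5 / 3 : ℝ) ≤
      4 * (a ^ (5 / 3 : ℝ) + b ^ (5 / 3 : ℝ) + c ^ (5 / 3 : ℝ) + d ^ (5 / 3 : ℝ)) := by
  have h2 : (2 : ℝ≥0∞) ^ ((5 / 3 : ℝ) - 1) ≤ 2 := by
    have h := ENNReal.rpow_le_rpow_of_exponent_le (x := 2) (by norm_num)
      (by norm_num : (5 / 3 : ℝ) - 1 ≤ 1)
    rwa [ENNReal.rpow_one] at h
  have htwo : ∀ x y : ℝ≥0∞, (x + y) ^ (5 / 3 : ℝ) ≤ 2 * (x ^ (5 / 3 : ℝ) + y ^ (5 / 3 : ℝ)) :=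
    fun x y => (ENNReal.rpow_add_le_mul_rpow_add_rpow x y (by norm_num : (1 : ℝ) ≤ 5 / 3)).trans
      (mul_le_mul' h2 le_rfl)
  calc (a + b + c + d) ^ (5 / 3 : ℝ) = ((a + b) + (c + d)) ^ (5 / 3 : ℝ) := by rw [add_assoc]
    _ ≤ 2 * ((a + b) ^ (5 / 3 : ℝ) + (c + d) ^ (5 / 3 : ℝ)) := htwo _ _
    _ ≤ 2 * (2 * (a ^ (5 / 3 : ℝ) + b ^ (5 / 3 : ℝ)) + 2 * (c ^ (5 / 3 : ℝ) + d ^ (5 / 3 : ℝ))) := by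
        gcongr
        · exact htwo a b
        · exact htwo c d
    _ = 4 * (a ^ (5 / 3 : ℝ) + b ^ (5 / 3 : ℝ) + c ^ (5 / 3 : ℝ) + d ^ (5 / 3 : ℝ)) := by ring

/-- `(a + b)^{10/3} ≤ 8 (a^{10/3} + b^{10/3})`. [folklore] -/
theorem rpow_ten_thirds_add_le (a b : ℝ≥0∞) :
    (a + b) ^ (10 / 3 : ℝ) ≤ 8 * (a ^ (10 / 3 : ℝ) + b ^ (10 / 3 : ℝ)) := by
  have h8 : (2 : ℝ≥0∞) ^ ((10 / 3 : ℝ) - 1) ≤ 8 := by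
    have h := ENNReal.rpow_le_rpow_of_exponent_le (x := 2) (by norm_num)
      (by norm_num : (10 / 3 : ℝ) - 1 ≤ 3)
    have e : (2 : ℝ≥0∞) ^ (3 : ℝ) = 8 := by
      rw [show (3 : ℝ) = ((3 : ℕ) : ℝ) by norm_num, ENNReal.rpow_natCast]; norm_num
    rwa [e] at h
  exact (ENNReal.rpow_add_le_mul_rpow_add_rpow a b (by norm_num : (1 : ℝ) ≤ 10 / 3)).trans
    (mul_le_mul' h8 le_rfl)

/-- `2^{5/3} ≤ 4`. [folklore] -/
theorem two_rpow_five_thirds_le : (2 : ℝ≥0∞) ^ (5 / 3 : ℝ) ≤ 4 := by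
  have h := ENNReal.rpow_le_rpow_of_exponent_le (x := 2) (by norm_num)
    (by norm_num : (5 / 3 : ℝ) ≤ 2)
  have e : (2 : ℝ≥0∞) ^ (2 : ℝ) = 4 := by rw [ENNReal.rpow_two]; norm_num
  rwa [e] at h

-- nested operator types
set_option maxSynthPendingDepth 3 in
/-- **Integrability of the Hessian pairing** `y ↦ D²φ(y)(w y)(w y)` for a test function `φ` and a
measurable field `w` with `|w|² ∈ L¹_loc` (the tree's
`integrable_bilin_apply_self_of_eq_zero_off_compact`). [folklore] -/
theorem integrable_hessian_apply_self {φ : EuclideanSpace ℝ (Fin 3) → ℝ}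
    (hφ : ContDiff ℝ (⊤ : ℕ∞) φ) (hφc : HasCompactSupport φ)
    {w : EuclideanSpace ℝ (Fin 3) → EuclideanSpace ℝ (Fin 3)} (hwm : AEStronglyMeasurable w volume)
    (hw2 : LocallyIntegrable (fun y => ‖w y‖ ^ 2) volume) :
    Integrable (fun y => fderiv ℝ (fderiv ℝ φ) y (w y) (w y))
      (volume : Measure (EuclideanSpace ℝ (Fin 3))) := by
  have hφ2 : ContDiff ℝ 2 φ := contDiff_infty.1 hφ 2
  have hHc : Continuous (fderiv ℝ (fderiv ℝ φ)) :=
    (hφ2.fderiv_right (m := 1) (by norm_num)).continuous_fderiv one_ne_zero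
  have hH0 : ∀ x ∉ tsupport φ, fderiv ℝ (fderiv ℝ φ) x = 0 := fun x hx =>
    fderiv_fderiv_eq_zero_of_notMem_tsupport hx
  exact integrable_bilin_apply_self_of_eq_zero_off_compact hφc hHc hH0 hwm.restrict
    (hw2.integrableOn_isCompact hφc)

/-- `w ∈ L^{10/3}(ℝ³) ⇒ |w|² ∈ L¹_loc(ℝ³)`. [folklore] -/
theorem locallyIntegrable_norm_sq_of_memLp
    {w : EuclideanSpace ℝ (Fin 3) → EuclideanSpace ℝ (Fin 3)} (hw : MemLp w (10 / 3) volume) :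
    LocallyIntegrable (fun y => ‖w y‖ ^ 2) (volume : Measure (EuclideanSpace ℝ (Fin 3))) := by
  rw [← two_mul_five_thirds] at hw
  exact (memLp_norm_sq_of_memLp_two_mul hw).locallyIntegrable one_lt_five_thirds.le

/-- **Integrability of `p̃[w] Δφ`** for `w ∈ L^{10/3}` and a test function `φ`. [folklore] -/
theorem integrable_normalisedPressure_mul_laplacian {φ : EuclideanSpace ℝ (Fin 3) → ℝ}
    (hφ : ContDiff ℝ (⊤ : ℕ∞) φ) (hφc : HasCompactSupport φ)
    {w : EuclideanSpace ℝ (Fin 3) → EuclideanSpace ℝ (Fin 3)} (hw : MemLp w (2 * (5 / 3)) volume) :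
    Integrable (fun y => normalisedPressure w y * Δ φ y) (volume : Measure (EuclideanSpace ℝ (Fin 3))) := by
  have hP : LocallyIntegrable (normalisedPressure w) volume :=
    (memLp_normalisedPressure_of_memLp_two_mul one_lt_five_thirds five_thirds_lt_top hw).locallyIntegrable
      one_lt_five_thirds.le
  have hΔ : Continuous (Δ φ) := continuous_laplacian (hφ.of_le (by norm_cast))
  have hΔc : HasCompactSupport (Δ φ) :=
    hφc.mono' fun x hx => by
      contrapose! hx
      exact notMem_support.2 (laplacian_eq_zero_of_notMem_tsupport hx)
  have h := hP.integrable_smul_left_of_hasCompactSupport hΔ hΔc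
  refine h.congr (ae_of_all _ fun y => ?_)
  simp only [smul_eq_mul]
  ring

/-! ### Slab classes of the four quadratic pressures -/

/-- **A.e. slice of the class `|w(s)|² ∈ L^{5/3}`** for a field in `L^{10/3}` of every time slab.
[folklore] -/
theorem ae_memLp_norm_sq_five_thirds {w : ℝ → EuclideanSpace ℝ (Fin 3) → EuclideanSpace ℝ (Fin 3)}
    (hw : ∀ a b : ℝ, MemLp (uncurry w) (10 / 3)
      (volume.restrict (Icc a b ×ˢ (univ : Set (EuclideanSpace ℝ (Fin 3)))))) :
    ∀ᵐ s : ℝ, MemLp (fun y => ‖w s y‖ ^ 2) (5 / 3) (volume : Measure (EuclideanSpace ℝ (Fin 3))) := by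
  have h0 : (10 / 3 : ℝ≥0∞) ≠ 0 := by
    rw [← two_mul_five_thirds]; exact mul_ne_zero two_ne_zero (zero_lt_one.trans one_lt_five_thirds).ne'
  have ht : (10 / 3 : ℝ≥0∞) ≠ ⊤ := by
    rw [← two_mul_five_thirds]; exact ENNReal.mul_ne_top ENNReal.ofNat_ne_top five_thirds_lt_top.ne
  filter_upwards [ae_memLp_slice_of_memLp_slabs h0 ht hw] with s hs
  rw [← two_mul_five_thirds] at hs
  exact memLp_norm_sq_of_memLp_two_mul hs

/-- **The quadratic pressure of a slab-`L^{10/3}` field is jointly measurable** on `ℝ × ℝ³`.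
[folklore] -/
theorem aestronglyMeasurable_normalisedPressure_of_slabs
    {w : ℝ → EuclideanSpace ℝ (Fin 3) → EuclideanSpace ℝ (Fin 3)}
    (hwm : AEStronglyMeasurable (uncurry w) volume)
    (hw : ∀ a b : ℝ, MemLp (uncurry w) (10 / 3)
      (volume.restrict (Icc a b ×ˢ (univ : Set (EuclideanSpace ℝ (Fin 3)))))) :
    AEStronglyMeasurable
      (fun z : ℝ × EuclideanSpace ℝ (Fin 3) => normalisedPressure (w z.1) z.2) volume := by
  have h := aestronglyMeasurable_normalisedPressure_slab one_lt_five_thirds five_thirds_lt_top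
    (I := (univ : Set ℝ)) (U := w) (by rw [univ_prod_univ, Measure.restrict_univ]; exact hwm)
    (ae_restrict_of_ae (ae_memLp_norm_sq_five_thirds hw))
  rwa [univ_prod_univ, Measure.restrict_univ] at h

/-- **Stein's bound on a time slab, exponents `10/3 → 5/3`**: with the constant `C` of
`lintegral_slab_normalisedPressure_rpow_le`, for a jointly measurable field `w` in `L^{10/3}` of
every time slab and every `I ⊆ ℝ`,
`∫∫_{I×ℝ³} |p̃[w]|^{5/3} ≤ C^{5/3} ∫∫_{I×ℝ³} |w|^{10/3}`. [cite: Stein1971, Ch. II §4.2 Thm 3 (b); BradshawTsai2017AHP, proof of Thm 2.4 (the L^{5/3} pressure bound)] -/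
theorem lintegral_slab_normalisedPressure_five_thirds_le :
    ∃ C : ℝ≥0, ∀ (I : Set ℝ) (w : ℝ → EuclideanSpace ℝ (Fin 3) → EuclideanSpace ℝ (Fin 3)),
      AEStronglyMeasurable (uncurry w) volume →
      (∀ a b : ℝ, MemLp (uncurry w) (10 / 3)
        (volume.restrict (Icc a b ×ˢ (univ : Set (EuclideanSpace ℝ (Fin 3)))))) →
      ∫⁻ z in I ×ˢ (univ : Set (EuclideanSpace ℝ (Fin 3))), ‖normalisedPressure (w z.1) z.2‖ₑ ^ (5 / 3 : ℝ) ≤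
        (C : ℝ≥0∞) ^ (5 / 3 : ℝ) *
          ∫⁻ z in I ×ˢ (univ : Set (EuclideanSpace ℝ (Fin 3))), ‖w z.1 z.2‖ₑ ^ (10 / 3 : ℝ) := by
  obtain ⟨C, hC⟩ := lintegral_slab_normalisedPressure_rpow_le (p := (5 / 3 : ℝ≥0∞))
    one_lt_five_thirds five_thirds_lt_top
  refine ⟨C, fun I w hwm hw => ?_⟩
  have h := hC I w hwm.restrict (ae_restrict_of_ae (ae_memLp_norm_sq_five_thirds hw))
  have e : (2 : ℝ) * (5 / 3) = 10 / 3 := by norm_num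
  simp only [toReal_five_thirds, e] at h
  exact h

/-- **The quadratic pressure of a slab-`L^{10/3}` field lies in `L^{5/3}` of every time slab.**
[cite: BradshawTsai2017AHP, proof of Thm 2.4 (the L^{5/3} pressure bound)] -/
theorem memLp_slab_normalisedPressure
    {w : ℝ → EuclideanSpace ℝ (Fin 3) → EuclideanSpace ℝ (Fin 3)}
    (hwm : AEStronglyMeasurable (uncurry w) volume)
    (hw : ∀ a b : ℝ, MemLp (uncurry w) (10 / 3)
      (volume.restrict (Icc a b ×ˢ (univ : Set (EuclideanSpace ℝ (Fin 3)))))) (a b : ℝ) :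
    MemLp (fun z : ℝ × EuclideanSpace ℝ (Fin 3) => normalisedPressure (w z.1) z.2) (5 / 3)
      (volume.restrict (Icc a b ×ˢ (univ : Set (EuclideanSpace ℝ (Fin 3))))) := by
  have h0 : (5 / 3 : ℝ≥0∞) ≠ 0 := (zero_lt_one.trans one_lt_five_thirds).ne'
  have h0' : (10 / 3 : ℝ≥0∞) ≠ 0 := by
    rw [← two_mul_five_thirds]; exact mul_ne_zero two_ne_zero h0
  have ht' : (10 / 3 : ℝ≥0∞) ≠ ⊤ := by
    rw [← two_mul_five_thirds]; exact ENNReal.mul_ne_top ENNReal.ofNat_ne_top five_thirds_lt_top.ne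
  obtain ⟨C, hC⟩ := lintegral_slab_normalisedPressure_five_thirds_le
  refine ⟨(aestronglyMeasurable_normalisedPressure_of_slabs hwm hw).restrict,
    (eLpNorm_lt_top_iff_lintegral_rpow_enorm_lt_top h0 five_thirds_lt_top.ne).2 ?_⟩
  rw [toReal_five_thirds]
  refine (hC (Icc a b) w hwm hw).trans_lt ?_
  have hfin := lintegral_rpow_enorm_lt_top_of_eLpNorm_lt_top h0' ht' (hw a b).2
  have e10 : (10 / 3 : ℝ≥0∞).toReal = 10 / 3 := by rw [ENNReal.toReal_div]; norm_num
  rw [e10] at hfin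
  exact ENNReal.mul_lt_top (ENNReal.rpow_lt_top_of_nonneg (by norm_num) ENNReal.coe_ne_top) hfin

/-- **The weak Poisson equation of the polarised pressure on a good slice**: if
`a, w, v ∈ L^{10/3}(ℝ³)`, then
`p = p̃[a + w] − (3/2)p̃[a] + ½p̃[a + v] − ½p̃[v]` solves `∫ p Δφ = −∫ (D²φ(w + v, a) + D²φ(a + w, w))`
for every test function `φ`. [cite: BradshawTsai2017AHP, proof of Thm 2.4 (the pressure p̃_ε "also satisfies −Δp = Σ ∂ᵢ∂ⱼ[…]")] -/
theorem integral_polarisedPressure_mul_laplacian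
    {a w v : EuclideanSpace ℝ (Fin 3) → EuclideanSpace ℝ (Fin 3)}
    (ha : MemLp a (10 / 3) volume) (hw : MemLp w (10 / 3) volume) (hv : MemLp v (10 / 3) volume)
    {φ : EuclideanSpace ℝ (Fin 3) → ℝ} (hφ : ContDiff ℝ (⊤ : ℕ∞) φ) (hφc : HasCompactSupport φ) :
    ∫ y, (normalisedPressure (a + w) y - 3 / 2 * normalisedPressure a y +
        1 / 2 * normalisedPressure (a + v) y - 1 / 2 * normalisedPressure v y) * Δ φ y =
      -∫ y, (fderiv ℝ (fderiv ℝ φ) y (w y + v y) (a y) +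
        fderiv ℝ (fderiv ℝ φ) y (a y + w y) (w y)) := by
  have haw : MemLp (a + w) (10 / 3) volume := ha.add hw
  have hav : MemLp (a + v) (10 / 3) volume := ha.add hv
  -- the four quadratic Poisson equations
  have P : ∀ {u : EuclideanSpace ℝ (Fin 3) → EuclideanSpace ℝ (Fin 3)}, MemLp u (10 / 3) volume →
      ∫ y, normalisedPressure u y * Δ φ y = -∫ y, fderiv ℝ (fderiv ℝ φ) y (u y) (u y) := by
    intro u hu
    rw [← two_mul_five_thirds] at hu
    exact integral_normalisedPressure_mul_laplacian_of_memLp one_lt_five_thirds five_thirds_lt_top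
      hu hφ hφc
  -- integrability of the eight integrands
  have I : ∀ {u : EuclideanSpace ℝ (Fin 3) → EuclideanSpace ℝ (Fin 3)}, MemLp u (10 / 3) volume →
      Integrable (fun y => normalisedPressure u y * Δ φ y)
        (volume : Measure (EuclideanSpace ℝ (Fin 3))) := by
    intro u hu
    rw [← two_mul_five_thirds] at hu
    exact integrable_normalisedPressure_mul_laplacian hφ hφc hu
  have J : ∀ {u : EuclideanSpace ℝ (Fin 3) → EuclideanSpace ℝ (Fin 3)}, MemLp u (10 / 3) volume →
      Integrable (fun y => fderiv ℝ (fderiv ℝ φ) y (u y) (u y))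
        (volume : Measure (EuclideanSpace ℝ (Fin 3))) := fun hu =>
    integrable_hessian_apply_self hφ hφc hu.1 (locallyIntegrable_norm_sq_of_memLp hu)
  -- left-hand side
  have eL : ∫ y, (normalisedPressure (a + w) y - 3 / 2 * normalisedPressure a y +
        1 / 2 * normalisedPressure (a + v) y - 1 / 2 * normalisedPressure v y) * Δ φ y =
      (∫ y, normalisedPressure (a + w) y * Δ φ y) - 3 / 2 * (∫ y, normalisedPressure a y * Δ φ y) +
        1 / 2 * (∫ y, normalisedPressure (a + v) y * Δ φ y) -
        1 / 2 * (∫ y, normalisedPressure v y * Δ φ y) := by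
    have e : (fun y => (normalisedPressure (a + w) y - 3 / 2 * normalisedPressure a y +
        1 / 2 * normalisedPressure (a + v) y - 1 / 2 * normalisedPressure v y) * Δ φ y) =
        fun y => normalisedPressure (a + w) y * Δ φ y - 3 / 2 * (normalisedPressure a y * Δ φ y) +
          1 / 2 * (normalisedPressure (a + v) y * Δ φ y) -
          1 / 2 * (normalisedPressure v y * Δ φ y) := by
      funext y; ring
    have i12 : Integrable (fun y => normalisedPressure (a + w) y * Δ φ y -
        3 / 2 * (normalisedPressure a y * Δ φ y)) (volume : Measure (EuclideanSpace ℝ (Fin 3))) :=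
      (I haw).sub ((I ha).const_mul _)
    have i123 : Integrable (fun y => normalisedPressure (a + w) y * Δ φ y -
        3 / 2 * (normalisedPressure a y * Δ φ y) + 1 / 2 * (normalisedPressure (a + v) y * Δ φ y))
        (volume : Measure (EuclideanSpace ℝ (Fin 3))) := i12.add ((I hav).const_mul _)
    rw [e, integral_sub i123 ((I hv).const_mul _), integral_add i12 ((I hav).const_mul _),
      integral_sub (I haw) ((I ha).const_mul _), integral_const_mul, integral_const_mul,
      integral_const_mul]
  -- right-hand side
  have eR : ∫ y, (fderiv ℝ (fderiv ℝ φ) y (w y + v y) (a y) +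
        fderiv ℝ (fderiv ℝ φ) y (a y + w y) (w y)) =
      (∫ y, fderiv ℝ (fderiv ℝ φ) y ((a + w) y) ((a + w) y)) -
        3 / 2 * (∫ y, fderiv ℝ (fderiv ℝ φ) y (a y) (a y)) +
        1 / 2 * (∫ y, fderiv ℝ (fderiv ℝ φ) y ((a + v) y) ((a + v) y)) -
        1 / 2 * (∫ y, fderiv ℝ (fderiv ℝ φ) y (v y) (v y)) := by
    have e : (fun y => fderiv ℝ (fderiv ℝ φ) y (w y + v y) (a y) +
        fderiv ℝ (fderiv ℝ φ) y (a y + w y) (w y)) =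
        fun y => fderiv ℝ (fderiv ℝ φ) y ((a + w) y) ((a + w) y) -
          3 / 2 * fderiv ℝ (fderiv ℝ φ) y (a y) (a y) +
          1 / 2 * fderiv ℝ (fderiv ℝ φ) y ((a + v) y) ((a + v) y) -
          1 / 2 * fderiv ℝ (fderiv ℝ φ) y (v y) (v y) := by
      funext y
      simp only [Pi.add_apply]
      exact (hessian_polarisation hφ y (a y) (w y) (v y)).symm
    have j12 : Integrable (fun y => fderiv ℝ (fderiv ℝ φ) y ((a + w) y) ((a + w) y) -
        3 / 2 * fderiv ℝ (fderiv ℝ φ) y (a y) (a y)) (volume : Measure (EuclideanSpace ℝ (Fin 3))) :=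
      (J haw).sub ((J ha).const_mul _)
    have j123 : Integrable (fun y => fderiv ℝ (fderiv ℝ φ) y ((a + w) y) ((a + w) y) -
        3 / 2 * fderiv ℝ (fderiv ℝ φ) y (a y) (a y) +
        1 / 2 * fderiv ℝ (fderiv ℝ φ) y ((a + v) y) ((a + v) y))
        (volume : Measure (EuclideanSpace ℝ (Fin 3))) := j12.add ((J hav).const_mul _)
    rw [e, integral_sub j123 ((J hv).const_mul _), integral_add j12 ((J hav).const_mul _),
      integral_sub (J haw) ((J ha).const_mul _), integral_const_mul, integral_const_mul,
      integral_const_mul]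
  rw [eL, eR, P haw, P ha, P hav, P hv]
  ring

/-- `(10/3 : ℝ≥0∞) ≠ 0`, `≠ ⊤`. [folklore] -/
theorem ten_thirds_ne_zero_and_ne_top : (10 / 3 : ℝ≥0∞) ≠ 0 ∧ (10 / 3 : ℝ≥0∞) ≠ ⊤ := by
  rw [← two_mul_five_thirds]
  exact ⟨mul_ne_zero two_ne_zero (zero_lt_one.trans one_lt_five_thirds).ne',
    ENNReal.mul_ne_top ENNReal.ofNat_ne_top five_thirds_lt_top.ne⟩

/-- Sums of slab-`L^{10/3}` fields are slab-`L^{10/3}`, in the `uncurry` form. [folklore] -/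
theorem memLp_slab_add {U₁ U₂ : ℝ → EuclideanSpace ℝ (Fin 3) → EuclideanSpace ℝ (Fin 3)} {q : ℝ≥0∞}
    (h₁ : ∀ a b : ℝ, MemLp (uncurry U₁) q
      (volume.restrict (Icc a b ×ˢ (univ : Set (EuclideanSpace ℝ (Fin 3))))))
    (h₂ : ∀ a b : ℝ, MemLp (uncurry U₂) q
      (volume.restrict (Icc a b ×ˢ (univ : Set (EuclideanSpace ℝ (Fin 3)))))) (a b : ℝ) :
    MemLp (uncurry fun s => U₁ s + U₂ s) q
      (volume.restrict (Icc a b ×ˢ (univ : Set (EuclideanSpace ℝ (Fin 3))))) :=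
  (h₁ a b).add (h₂ a b)

/-- `∫∫ |F₁ + F₂|^{10/3} ≤ 8 (∫∫ |F₁|^{10/3} + ∫∫ |F₂|^{10/3})`, for an a.e.-measurable `F₁`.
[folklore] -/
theorem lintegral_enorm_add_rpow_ten_thirds_le {μ : Measure (ℝ × EuclideanSpace ℝ (Fin 3))}
    {F₁ F₂ : ℝ × EuclideanSpace ℝ (Fin 3) → EuclideanSpace ℝ (Fin 3)}
    (h₁ : AEStronglyMeasurable F₁ μ) :
    ∫⁻ z, ‖F₁ z + F₂ z‖ₑ ^ (10 / 3 : ℝ) ∂μ ≤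
      8 * ((∫⁻ z, ‖F₁ z‖ₑ ^ (10 / 3 : ℝ) ∂μ) + ∫⁻ z, ‖F₂ z‖ₑ ^ (10 / 3 : ℝ) ∂μ) := by
  calc ∫⁻ z, ‖F₁ z + F₂ z‖ₑ ^ (10 / 3 : ℝ) ∂μ
      ≤ ∫⁻ z, 8 * (‖F₁ z‖ₑ ^ (10 / 3 : ℝ) + ‖F₂ z‖ₑ ^ (10 / 3 : ℝ)) ∂μ := by
        refine lintegral_mono fun z => ?_
        exact (ENNReal.rpow_le_rpow (enorm_add_le _ _) (by norm_num)).trans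
          (rpow_ten_thirds_add_le _ _)
    _ = 8 * ((∫⁻ z, ‖F₁ z‖ₑ ^ (10 / 3 : ℝ) ∂μ) + ∫⁻ z, ‖F₂ z‖ₑ ^ (10 / 3 : ℝ) ∂μ) := by
        rw [lintegral_const_mul' _ _ (by norm_num), lintegral_add_left' (h₁.enorm.pow_const _)]

/-- `‖c x‖ₑ^{5/3} ≤ 4‖x‖ₑ^{5/3}` for `|c| ≤ 2`. [folklore] -/
theorem enorm_const_mul_rpow_five_thirds_le {c : ℝ} (hc : |c| ≤ 2) (x : ℝ) :
    ‖c * x‖ₑ ^ (5 / 3 : ℝ) ≤ 4 * ‖x‖ₑ ^ (5 / 3 : ℝ) := by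
  rw [enorm_mul, ENNReal.mul_rpow_of_nonneg _ _ (by norm_num)]
  refine mul_le_mul' ?_ le_rfl
  calc ‖c‖ₑ ^ (5 / 3 : ℝ) ≤ (2 : ℝ≥0∞) ^ (5 / 3 : ℝ) := by
        refine ENNReal.rpow_le_rpow ?_ (by norm_num)
        rw [Real.enorm_eq_ofReal_abs]
        have h2 : ENNReal.ofReal |c| ≤ ENNReal.ofReal 2 := ENNReal.ofReal_le_ofReal hc
        rwa [ENNReal.ofReal_ofNat] at h2
    _ ≤ 4 := two_rpow_five_thirds_le

/-- **Pointwise bound for the polarised combination**: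
`|a − (3/2)b + ½c − ½d|^{5/3} ≤ 16 (|a|^{5/3} + |b|^{5/3} + |c|^{5/3} + |d|^{5/3})`. [folklore] -/
theorem enorm_polarised_rpow_le (a b c d : ℝ) :
    ‖a - 3 / 2 * b + 1 / 2 * c - 1 / 2 * d‖ₑ ^ (5 / 3 : ℝ) ≤
      16 * (‖a‖ₑ ^ (5 / 3 : ℝ) + ‖b‖ₑ ^ (5 / 3 : ℝ) + ‖c‖ₑ ^ (5 / 3 : ℝ) + ‖d‖ₑ ^ (5 / 3 : ℝ)) := by
  have htri : ‖a - 3 / 2 * b + 1 / 2 * c - 1 / 2 * d‖ₑ ≤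
      ‖a‖ₑ + ‖3 / 2 * b‖ₑ + ‖1 / 2 * c‖ₑ + ‖1 / 2 * d‖ₑ :=
    calc ‖a - 3 / 2 * b + 1 / 2 * c - 1 / 2 * d‖ₑ
        ≤ ‖a - 3 / 2 * b + 1 / 2 * c‖ₑ + ‖1 / 2 * d‖ₑ := enorm_sub_le
      _ ≤ ‖a - 3 / 2 * b‖ₑ + ‖1 / 2 * c‖ₑ + ‖1 / 2 * d‖ₑ := by
          gcongr; exact enorm_add_le _ _
      _ ≤ ‖a‖ₑ + ‖3 / 2 * b‖ₑ + ‖1 / 2 * c‖ₑ + ‖1 / 2 * d‖ₑ := by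
          gcongr; exact enorm_sub_le
  have h32 : |(3 / 2 : ℝ)| ≤ 2 := by rw [abs_of_pos (by norm_num : (0:ℝ) < 3 / 2)]; norm_num
  have h12 : |(1 / 2 : ℝ)| ≤ 2 := by rw [abs_of_pos (by norm_num : (0:ℝ) < 1 / 2)]; norm_num
  have ha : ‖a‖ₑ ^ (5 / 3 : ℝ) ≤ 4 * ‖a‖ₑ ^ (5 / 3 : ℝ) :=
    calc ‖a‖ₑ ^ (5 / 3 : ℝ) = 1 * ‖a‖ₑ ^ (5 / 3 : ℝ) := (one_mul _).symm
      _ ≤ 4 * ‖a‖ₑ ^ (5 / 3 : ℝ) := mul_le_mul' (by norm_num) le_rfl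
  have hb := enorm_const_mul_rpow_five_thirds_le h32 b
  have hc := enorm_const_mul_rpow_five_thirds_le h12 c
  have hd := enorm_const_mul_rpow_five_thirds_le h12 d
  calc ‖a - 3 / 2 * b + 1 / 2 * c - 1 / 2 * d‖ₑ ^ (5 / 3 : ℝ)
      ≤ (‖a‖ₑ + ‖3 / 2 * b‖ₑ + ‖1 / 2 * c‖ₑ + ‖1 / 2 * d‖ₑ) ^ (5 / 3 : ℝ) :=
        ENNReal.rpow_le_rpow htri (by norm_num)
    _ ≤ 4 * (‖a‖ₑ ^ (5 / 3 : ℝ) + ‖3 / 2 * b‖ₑ ^ (5 / 3 : ℝ) + ‖1 / 2 * c‖ₑ ^ (5 / 3 : ℝ) +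
          ‖1 / 2 * d‖ₑ ^ (5 / 3 : ℝ)) := rpow_five_thirds_add_four_le _ _ _ _
    _ ≤ 4 * (4 * ‖a‖ₑ ^ (5 / 3 : ℝ) + 4 * ‖b‖ₑ ^ (5 / 3 : ℝ) + 4 * ‖c‖ₑ ^ (5 / 3 : ℝ) +
          4 * ‖d‖ₑ ^ (5 / 3 : ℝ)) := by gcongr
    _ = 16 * (‖a‖ₑ ^ (5 / 3 : ℝ) + ‖b‖ₑ ^ (5 / 3 : ℝ) + ‖c‖ₑ ^ (5 / 3 : ℝ) + ‖d‖ₑ ^ (5 / 3 : ℝ)) := by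
        ring

/-- **The `L^{5/3}` bound of the polarised pressure on a time slab**: there is an absolute
`C < ∞` (a multiple of a power of Stein's constant) such that for jointly measurable
slab-`L^{10/3}` fields `U`, `W`, `V` and every `I ⊆ ℝ`,
`∫∫_{I×ℝ³} |p̃[U+W] − (3/2)p̃[U] + ½p̃[U+V] − ½p̃[V]|^{5/3} ≤ C ∫∫_{I×ℝ³} (|U|^{10/3} + |W|^{10/3} + |V|^{10/3})`.
[cite: BradshawTsai2017AHP, proof of Thm 2.4 ("‖p_ε‖_{L^{5/3}(ℝ³×[0,T])} ≤ C‖U_ε‖²_{L^{10/3}} + C‖W‖²_{L^{10/3}}")] -/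
theorem lintegral_polarisedPressure_rpow_le :
    ∃ C : ℝ≥0∞, C ≠ ⊤ ∧ ∀ (I : Set ℝ)
      {U W V : ℝ → EuclideanSpace ℝ (Fin 3) → EuclideanSpace ℝ (Fin 3)},
      AEStronglyMeasurable (uncurry U) volume → AEStronglyMeasurable (uncurry W) volume →
      AEStronglyMeasurable (uncurry V) volume →
      (∀ a b : ℝ, MemLp (uncurry U) (10 / 3)
        (volume.restrict (Icc a b ×ˢ (univ : Set (EuclideanSpace ℝ (Fin 3)))))) →
      (∀ a b : ℝ, MemLp (uncurry W) (10 / 3)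
        (volume.restrict (Icc a b ×ˢ (univ : Set (EuclideanSpace ℝ (Fin 3)))))) →
      (∀ a b : ℝ, MemLp (uncurry V) (10 / 3)
        (volume.restrict (Icc a b ×ˢ (univ : Set (EuclideanSpace ℝ (Fin 3)))))) →
      ∫⁻ z in I ×ˢ (univ : Set (EuclideanSpace ℝ (Fin 3))),
          ‖normalisedPressure (U z.1 + W z.1) z.2 - 3 / 2 * normalisedPressure (U z.1) z.2 +
            1 / 2 * normalisedPressure (U z.1 + V z.1) z.2 -
            1 / 2 * normalisedPressure (V z.1) z.2‖ₑ ^ (5 / 3 : ℝ) ≤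
        C * ((∫⁻ z in I ×ˢ (univ : Set (EuclideanSpace ℝ (Fin 3))), ‖U z.1 z.2‖ₑ ^ (10 / 3 : ℝ)) +
          (∫⁻ z in I ×ˢ (univ : Set (EuclideanSpace ℝ (Fin 3))), ‖W z.1 z.2‖ₑ ^ (10 / 3 : ℝ)) +
          ∫⁻ z in I ×ˢ (univ : Set (EuclideanSpace ℝ (Fin 3))), ‖V z.1 z.2‖ₑ ^ (10 / 3 : ℝ)) := by
  obtain ⟨Cs, hCs⟩ := lintegral_slab_normalisedPressure_five_thirds_le
  refine ⟨512 * (Cs : ℝ≥0∞) ^ (5 / 3 : ℝ),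
    ENNReal.mul_ne_top (by norm_num) (ENNReal.rpow_ne_top_of_nonneg (by norm_num) ENNReal.coe_ne_top),
    ?_⟩
  intro I U W V hUm hWm hVm hU hW hV
  -- the four fields and their classes
  have hUWm : AEStronglyMeasurable (uncurry fun s => U s + W s) volume := hUm.add hWm
  have hUVm : AEStronglyMeasurable (uncurry fun s => U s + V s) volume := hUm.add hVm
  have hUW : ∀ a b : ℝ, MemLp (uncurry fun s => U s + W s) (10 / 3)
      (volume.restrict (Icc a b ×ˢ (univ : Set (EuclideanSpace ℝ (Fin 3))))) := memLp_slab_add hU hW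
  have hUV : ∀ a b : ℝ, MemLp (uncurry fun s => U s + V s) (10 / 3)
      (volume.restrict (Icc a b ×ˢ (univ : Set (EuclideanSpace ℝ (Fin 3))))) := memLp_slab_add hU hV
  -- Stein's bound for the four quadratic pressures
  have s₁ := hCs I (fun s => U s + W s) hUWm hUW
  have s₂ := hCs I U hUm hU
  have s₃ := hCs I (fun s => U s + V s) hUVm hUV
  have s₄ := hCs I V hVm hV
  simp only [Pi.add_apply] at s₁ s₃
  -- `|U₁ + U₂|^{10/3} ≤ 8 (|U₁|^{10/3} + |U₂|^{10/3})`
  have a₁ := lintegral_enorm_add_rpow_ten_thirds_le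
    (μ := volume.restrict (I ×ˢ (univ : Set (EuclideanSpace ℝ (Fin 3)))))
    (F₁ := fun z => U z.1 z.2) (F₂ := fun z => W z.1 z.2) hUm.restrict
  have a₃ := lintegral_enorm_add_rpow_ten_thirds_le
    (μ := volume.restrict (I ×ˢ (univ : Set (EuclideanSpace ℝ (Fin 3)))))
    (F₁ := fun z => U z.1 z.2) (F₂ := fun z => V z.1 z.2) hUm.restrict
  beta_reduce at a₁ a₃
  -- measurability of the pressures on the slab
  have m₁ : AEStronglyMeasurable
      (fun z : ℝ × EuclideanSpace ℝ (Fin 3) => normalisedPressure (U z.1 + W z.1) z.2)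
      (volume.restrict (I ×ˢ (univ : Set (EuclideanSpace ℝ (Fin 3))))) :=
    (aestronglyMeasurable_normalisedPressure_of_slabs hUWm hUW).restrict
  have m₂ : AEStronglyMeasurable
      (fun z : ℝ × EuclideanSpace ℝ (Fin 3) => normalisedPressure (U z.1) z.2)
      (volume.restrict (I ×ˢ (univ : Set (EuclideanSpace ℝ (Fin 3))))) :=
    (aestronglyMeasurable_normalisedPressure_of_slabs hUm hU).restrict
  have m₃ : AEStronglyMeasurable
      (fun z : ℝ × EuclideanSpace ℝ (Fin 3) => normalisedPressure (U z.1 + V z.1) z.2)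
      (volume.restrict (I ×ˢ (univ : Set (EuclideanSpace ℝ (Fin 3))))) :=
    (aestronglyMeasurable_normalisedPressure_of_slabs hUVm hUV).restrict
  -- abbreviations
  set μ : Measure (ℝ × EuclideanSpace ℝ (Fin 3)) :=
    volume.restrict (I ×ˢ (univ : Set (EuclideanSpace ℝ (Fin 3)))) with hμ
  set K : ℝ≥0∞ := (Cs : ℝ≥0∞) ^ (5 / 3 : ℝ) with hK
  set IU : ℝ≥0∞ := ∫⁻ z, ‖U z.1 z.2‖ₑ ^ (10 / 3 : ℝ) ∂μ with hIU
  set IW : ℝ≥0∞ := ∫⁻ z, ‖W z.1 z.2‖ₑ ^ (10 / 3 : ℝ) ∂μ with hIW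
  set IV : ℝ≥0∞ := ∫⁻ z, ‖V z.1 z.2‖ₑ ^ (10 / 3 : ℝ) ∂μ with hIV
  set J₁ : ℝ≥0∞ := ∫⁻ z, ‖normalisedPressure (U z.1 + W z.1) z.2‖ₑ ^ (5 / 3 : ℝ) ∂μ with hJ₁
  set J₂ : ℝ≥0∞ := ∫⁻ z, ‖normalisedPressure (U z.1) z.2‖ₑ ^ (5 / 3 : ℝ) ∂μ with hJ₂
  set J₃ : ℝ≥0∞ := ∫⁻ z, ‖normalisedPressure (U z.1 + V z.1) z.2‖ₑ ^ (5 / 3 : ℝ) ∂μ with hJ₃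
  set J₄ : ℝ≥0∞ := ∫⁻ z, ‖normalisedPressure (V z.1) z.2‖ₑ ^ (5 / 3 : ℝ) ∂μ with hJ₄
  have b₁ : J₁ ≤ K * (8 * (IU + IW + IV)) :=
    s₁.trans (mul_le_mul' le_rfl (a₁.trans (mul_le_mul' le_rfl le_self_add)))
  have b₂ : J₂ ≤ K * (8 * (IU + IW + IV)) := by
    refine s₂.trans (mul_le_mul' le_rfl ?_)
    calc IU ≤ IU + IW + IV := by rw [add_assoc]; exact le_self_add
      _ = 1 * (IU + IW + IV) := (one_mul _).symm
      _ ≤ 8 * (IU + IW + IV) := mul_le_mul' (by norm_num) le_rfl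
  have b₃ : J₃ ≤ K * (8 * (IU + IW + IV)) := by
    refine s₃.trans (mul_le_mul' le_rfl (a₃.trans (mul_le_mul' le_rfl ?_)))
    calc IU + IV ≤ IU + IV + IW := le_self_add
      _ = IU + IW + IV := add_right_comm _ _ _
  have b₄ : J₄ ≤ K * (8 * (IU + IW + IV)) := by
    refine s₄.trans (mul_le_mul' le_rfl ?_)
    calc IV ≤ IU + IW + IV := le_add_self
      _ = 1 * (IU + IW + IV) := (one_mul _).symm
      _ ≤ 8 * (IU + IW + IV) := mul_le_mul' (by norm_num) le_rfl
  -- assemble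
  calc ∫⁻ z, ‖normalisedPressure (U z.1 + W z.1) z.2 - 3 / 2 * normalisedPressure (U z.1) z.2 +
          1 / 2 * normalisedPressure (U z.1 + V z.1) z.2 -
          1 / 2 * normalisedPressure (V z.1) z.2‖ₑ ^ (5 / 3 : ℝ) ∂μ
      ≤ ∫⁻ z, 16 * (‖normalisedPressure (U z.1 + W z.1) z.2‖ₑ ^ (5 / 3 : ℝ) +
          ‖normalisedPressure (U z.1) z.2‖ₑ ^ (5 / 3 : ℝ) +
          ‖normalisedPressure (U z.1 + V z.1) z.2‖ₑ ^ (5 / 3 : ℝ) +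
          ‖normalisedPressure (V z.1) z.2‖ₑ ^ (5 / 3 : ℝ)) ∂μ :=
        lintegral_mono fun z => enorm_polarised_rpow_le _ _ _ _
    _ = 16 * (J₁ + J₂ + J₃ + J₄) := by
        have n₁ : AEMeasurable (fun z : ℝ × EuclideanSpace ℝ (Fin 3) =>
            ‖normalisedPressure (U z.1 + W z.1) z.2‖ₑ ^ (5 / 3 : ℝ)) μ := m₁.enorm.pow_const _
        have n₁₂ : AEMeasurable (fun z : ℝ × EuclideanSpace ℝ (Fin 3) =>
            ‖normalisedPressure (U z.1 + W z.1) z.2‖ₑ ^ (5 / 3 : ℝ) +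
              ‖normalisedPressure (U z.1) z.2‖ₑ ^ (5 / 3 : ℝ)) μ := n₁.add (m₂.enorm.pow_const _)
        have n₁₂₃ : AEMeasurable (fun z : ℝ × EuclideanSpace ℝ (Fin 3) =>
            ‖normalisedPressure (U z.1 + W z.1) z.2‖ₑ ^ (5 / 3 : ℝ) +
              ‖normalisedPressure (U z.1) z.2‖ₑ ^ (5 / 3 : ℝ) +
              ‖normalisedPressure (U z.1 + V z.1) z.2‖ₑ ^ (5 / 3 : ℝ)) μ :=
          n₁₂.add (m₃.enorm.pow_const _)
        rw [lintegral_const_mul' _ _ (by norm_num), lintegral_add_left' n₁₂₃,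
          lintegral_add_left' n₁₂, lintegral_add_left' n₁]
    _ ≤ 16 * (K * (8 * (IU + IW + IV)) + K * (8 * (IU + IW + IV)) + K * (8 * (IU + IW + IV)) +
          K * (8 * (IU + IW + IV))) := by gcongr
    _ = 512 * K * (IU + IW + IV) := by ring

/-- **The [BT1] Riesz pressure and its properties.** Let `T > 0` and let `U`, `W`, `V` be jointly
a.e.-strongly measurable, `T`-periodic fields on `ℝ × ℝ³` belonging to `L^{10/3}` of every time
slab `[a, b] × ℝ³`. Then the polarised Riesz pressure
`p(s) = p̃[U(s)+W(s)] − (3/2)p̃[U(s)] + ½p̃[U(s)+V(s)] − ½p̃[V(s)]` is `T`-periodic, a.e.-strongly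
measurable on `ℝ × ℝ³`, in `L^{5/3}` of every time slab (hence locally integrable), solves for
a.e. `s` the weak pressure Poisson equation
`∫ p(s) Δφ = −∫ (D²φ(W(s)+V(s), U(s)) + D²φ(U(s)+W(s), W(s)))` for all test functions `φ`, and
obeys `∫∫_{(0,T)×ℝ³} |p|^{5/3} ≤ C ∫∫_{(0,T)×ℝ³} (|U|^{10/3} + |W|^{10/3} + |V|^{10/3})` with an
absolute constant `C` (independent of `T` and of the fields: in [BT1], of `ε`). [cite: BradshawTsai2017AHP, proof of Thm 2.4 (p̃_ε, its Poisson equation, the L^{5/3} bound)] -/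
theorem exists_rieszPressure :
    ∃ C : ℝ≥0∞, C ≠ ⊤ ∧ ∀ {T : ℝ}, 0 < T →
      ∀ {U W V : ℝ → EuclideanSpace ℝ (Fin 3) → EuclideanSpace ℝ (Fin 3)},
      AEStronglyMeasurable (uncurry U) volume → AEStronglyMeasurable (uncurry W) volume →
      AEStronglyMeasurable (uncurry V) volume →
      (∀ s y, U (s + T) y = U s y) → (∀ s y, W (s + T) y = W s y) →
      (∀ s y, V (s + T) y = V s y) →
      (∀ a b : ℝ, MemLp (uncurry U) (10 / 3)
        (volume.restrict (Icc a b ×ˢ (univ : Set (EuclideanSpace ℝ (Fin 3)))))) →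
      (∀ a b : ℝ, MemLp (uncurry W) (10 / 3)
        (volume.restrict (Icc a b ×ˢ (univ : Set (EuclideanSpace ℝ (Fin 3)))))) →
      (∀ a b : ℝ, MemLp (uncurry V) (10 / 3)
        (volume.restrict (Icc a b ×ˢ (univ : Set (EuclideanSpace ℝ (Fin 3)))))) →
      ∃ p : ℝ → EuclideanSpace ℝ (Fin 3) → ℝ,
        (∀ s y, p (s + T) y = p s y) ∧
        AEStronglyMeasurable (uncurry p) volume ∧
        (∀ a b : ℝ, MemLp (uncurry p) (5 / 3)
          (volume.restrict (Icc a b ×ˢ (univ : Set (EuclideanSpace ℝ (Fin 3)))))) ∧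
        LocallyIntegrable (uncurry p) volume ∧
        (∀ᵐ s : ℝ, ∀ φ : EuclideanSpace ℝ (Fin 3) → ℝ, ContDiff ℝ (⊤ : ℕ∞) φ →
          HasCompactSupport φ →
          ∫ y, p s y * Δ φ y = -∫ y, (fderiv ℝ (fderiv ℝ φ) y (W s y + V s y) (U s y) +
            fderiv ℝ (fderiv ℝ φ) y (U s y + W s y) (W s y))) ∧
        ∫⁻ z in Ioo 0 T ×ˢ (univ : Set (EuclideanSpace ℝ (Fin 3))), ‖p z.1 z.2‖ₑ ^ (5 / 3 : ℝ) ≤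
          C * ((∫⁻ z in Ioo 0 T ×ˢ (univ : Set (EuclideanSpace ℝ (Fin 3))),
              ‖U z.1 z.2‖ₑ ^ (10 / 3 : ℝ)) +
            (∫⁻ z in Ioo 0 T ×ˢ (univ : Set (EuclideanSpace ℝ (Fin 3))),
              ‖W z.1 z.2‖ₑ ^ (10 / 3 : ℝ)) +
            ∫⁻ z in Ioo 0 T ×ˢ (univ : Set (EuclideanSpace ℝ (Fin 3))),
              ‖V z.1 z.2‖ₑ ^ (10 / 3 : ℝ)) := by
  obtain ⟨C, hC, hbound⟩ := lintegral_polarisedPressure_rpow_le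
  refine ⟨C, hC, ?_⟩
  intro T hT U W V hUm hWm hVm hUT hWT hVT hU hW hV
  obtain ⟨h0', ht'⟩ := ten_thirds_ne_zero_and_ne_top
  -- the four fields and their classes
  have hUWm : AEStronglyMeasurable (uncurry fun s => U s + W s) volume := hUm.add hWm
  have hUVm : AEStronglyMeasurable (uncurry fun s => U s + V s) volume := hUm.add hVm
  have hUW : ∀ a b : ℝ, MemLp (uncurry fun s => U s + W s) (10 / 3)
      (volume.restrict (Icc a b ×ˢ (univ : Set (EuclideanSpace ℝ (Fin 3))))) := memLp_slab_add hU hW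
  have hUV : ∀ a b : ℝ, MemLp (uncurry fun s => U s + V s) (10 / 3)
      (volume.restrict (Icc a b ×ˢ (univ : Set (EuclideanSpace ℝ (Fin 3))))) := memLp_slab_add hU hV
  -- the pressure as a space–time function
  set P : ℝ × EuclideanSpace ℝ (Fin 3) → ℝ := fun z =>
    normalisedPressure (U z.1 + W z.1) z.2 - 3 / 2 * normalisedPressure (U z.1) z.2 +
      1 / 2 * normalisedPressure (U z.1 + V z.1) z.2 - 1 / 2 * normalisedPressure (V z.1) z.2 with hP
  have hPm : AEStronglyMeasurable P volume := by
    rw [hP]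
    exact (((aestronglyMeasurable_normalisedPressure_of_slabs hUWm hUW).sub
      ((aestronglyMeasurable_normalisedPressure_of_slabs hUm hU).const_mul _)).add
      ((aestronglyMeasurable_normalisedPressure_of_slabs hUVm hUV).const_mul _)).sub
      ((aestronglyMeasurable_normalisedPressure_of_slabs hVm hV).const_mul _)
  have hPslab : ∀ a b : ℝ, MemLp P (5 / 3)
      (volume.restrict (Icc a b ×ˢ (univ : Set (EuclideanSpace ℝ (Fin 3))))) := by
    intro a b
    rw [hP]
    exact (((memLp_slab_normalisedPressure hUWm hUW a b).sub
      ((memLp_slab_normalisedPressure hUm hU a b).const_mul _)).add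
      ((memLp_slab_normalisedPressure hUVm hUV a b).const_mul _)).sub
      ((memLp_slab_normalisedPressure hVm hV a b).const_mul _)
  refine ⟨fun s y => P (s, y), ?_, ?_, ?_, ?_, ?_, ?_⟩
  · -- periodicity
    intro s y
    have eU : U (s + T) = U s := funext (hUT s)
    have eW : W (s + T) = W s := funext (hWT s)
    have eV : V (s + T) = V s := funext (hVT s)
    simp only [hP, eU, eW, eV]
  · -- joint measurability
    exact hPm
  · -- the slab class `L^{5/3}`
    exact hPslab
  · -- local integrability
    exact locallyIntegrable_of_memLp_slab (q := (5 / 3 : ℝ≥0∞)) one_lt_five_thirds.le hPslab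
  · -- the slice-wise weak Poisson equation
    filter_upwards [ae_memLp_slice_of_memLp_slabs h0' ht' hU,
      ae_memLp_slice_of_memLp_slabs h0' ht' hW, ae_memLp_slice_of_memLp_slabs h0' ht' hV]
      with s hUs hWs hVs φ hφ hφc
    simp only [hP]
    exact integral_polarisedPressure_mul_laplacian hUs hWs hVs hφ hφc
  · -- the `L^{5/3}` bound on a period
    simp only [hP]
    exact hbound (Ioo 0 T) hUm hWm hVm hU hW hV

end BradshawTsai2017

end Literature.Analysis.FluidPDE

end
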